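import Summits.ResolutionOfSingularities.ResolutionOfSingularities.Theorems.MarkedTransferCampaignW46TameSurfaceOrderReduction
import Literature.AlgebraicGeometry.Resolution.KollarSurfaceOrderReductionTameDimLeTwo
import HarnessLib

/-!
# [OURS · L1 W4.6, rung (iv) «large characteristic» ∩ rung (i) «surfaces»] In the regime
# `charGT n (fun _ b ↦ b) ∩ dimLE 2` the characteristic-zero order reduction terminates LOCALLY at EVERY closed point of
# every state of maximal order of the TYPED procedure (cell res-hironaka, LADDER-RESOLUTION rung L, D-0089; slot W4.6,
# seat res-L1-s46-pv-7; host route MarkedTransfer, `--supports stmt-ResolutionOfSingularities-16155 --as helper`)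

HONEST FRAMING. Nothing here is a statement of H. Hironaka's manuscript (2017-03-23, [Hironaka2017]) and nothing here
asserts that any statement of it holds. OURS corollaries, over the shared typed-procedure module
`MarkedTransferCampaignW46TypedProcedure` (res-L1-type-o1: `CampaignW46.Regime.charGT`, `Regime.dimLE`, `Regime.inter`;
the manuscript enters only through the typed CANDIDATE carriers `AmbientDatum`, `IdealExponent`, `IdealExponent.sing`,
used as definitions), of this seat's Literature files `KollarSurfaceOrderReductionTame{,Local,DimLeTwo}.lean` (local
order reduction for marked ideals `(I, b)`, `max-ord I ≤ b < p`, at every closed point of dimension `≤ 2` of a scheme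
smooth over a perfect field; the dimension-one step `MarkedCurveOrderReduction.lean` is characteristic-free). Companion
of `MarkedTransferCampaignW46TameSurfaceOrderReduction.lean` (p546685: the closed points with `dim 𝒪_{Z,ξ} = 2`). No
premise of the manuscript, no FACT-LIST premise. AI review is weaker than expert review. No `sorry`, no new
definition; axioms standard.

## What this file pins

* `exists_isResolutionOf_nhd_of_charGT_dimLE` — for a state `(A, E)`, `E = (J, b)`, over a PERFECT field `K` of
  characteristic `p`, in the regime `Regime.inter (Regime.charGT n (fun _ b ↦ b)) (Regime.dimLE 2)` («`p > b`» and
  «`dim Z ≤ 2`», the typed rungs (iv) ∩ (i)), with `1 ≤ b` and `J` of maximal order `b`: EVERY CLOSED POINT `ξ ∈ Z`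
  has an open neighbourhood `U` carrying a smooth blow-up sequence which RESOLVES `(U, J|_U, ∅, b)` (BGMW Def. 3.1.3,
  tree `CentreSeq.IsResolutionOf`). Instance of `Kollar2007.exists_isResolutionOf_nhd_of_topologicalKrullDim_le_two`;
* `exists_isResolutionOf_nhd_of_charGT_of_ringKrullDim_le_two` — the same at every closed point `ξ` with
  `dim 𝒪_{Z,ξ} ≤ 2` of a state of any dimension;
* `exists_isResolutionOf_nhd_of_le_dimLE` — the same in every regime `Regime.charGT n f ∩ Regime.dimLE 2` with
  `(fun _ b ↦ b) ≤ f`.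

The honest `C` of «the typed procedure terminates for `p > C(n, d)`» for `n = dim Z ≤ 2` is therefore the order `b`,
locally at every closed point and with Kollár's centres; the global assembly of these local sequences on `Z` (Kollár's
globalisation 3.105, by functoriality) is not written.

## References (context; nothing is cited as a premise)

* J. Kollár, *Lectures on Resolution of Singularities* (2007), Thm. 3.69, 3.70, 3.104 Step 2.2, 3.111 Step 1 — through
  this seat's Literature files. [cite: Kollar2007, Thm. 3.69]
* E. Bierstone, D. Grigoriev, P. Milman, J. Włodarczyk (2011), Def. 3.1.3, Thm. 8.0.4.
  [cite: BierstoneGrigorievMilmanWlodarczyk2011, Thm. 8.0.4]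
-/

noncomputable section

set_option linter.dupNamespace false -- mandated namespace of this single-conjunct summit

open CategoryTheory AlgebraicGeometry TopologicalSpace IsLocalRing

namespace Summit.ResolutionOfSingularities.ResolutionOfSingularities.Theorems
namespace CampaignW46
namespace TameSurfaceOrderReduction

open Literature.AlgebraicGeometry.Resolution
open Literature.AlgebraicGeometry.Hironaka2017.S02Preliminaries

universe u

variable {n : ℕ} {p : ℕ} [Fact p.Prime] {K : Type u} [Field K] [CharP K p]

/-- [OURS · L1 W4.6 (iv) ∩ (i); NOT a statement of the manuscript] **At every closed point of dimension `≤ 2`.** For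
`(A, E)`, `E = (J, b)`, over a perfect field `K` of characteristic `p`, in `Regime.charGT n (fun _ b ↦ b)` (`b < p`), with
`1 ≤ b` and `ord_ξ J ≤ b` everywhere: every closed point `ξ ∈ Z` with `dim 𝒪_{Z,ξ} ≤ 2` has an open `U ∋ ξ` and a smooth
blow-up sequence on `U` RESOLVING `(U, J|_U, ∅, b)`. Instance of
`Kollar2007.exists_isResolutionOf_nhd_of_ringKrullDim_le_two` (surface points: maximal-contact curve + order reduction
in dimension one, or one blowing up of a curve of `Sing(E)`; points of dimension `≤ 1`: one blowing up of the point,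
or nothing). [cite: Kollar2007, Thm. 3.69] -/
theorem exists_isResolutionOf_nhd_of_charGT_of_ringKrullDim_le_two [PerfectField K] (A : AmbientDatum p K)
    (E : IdealExponent A.Z) (hE : Regime.charGT (p := p) (K := K) n (fun _ b => b) A E) (hb : 1 ≤ E.b)
    (hmax : ∀ ξ : A.Z, idealOrder E.J ξ ≤ E.b) (ξ : A.Z) (hξ : IsClosed ({ξ} : Set A.Z))
    (hdim : ringKrullDim (A.Z.presheaf.stalk ξ) ≤ 2) :
    ∃ (U : A.Z.Opens) (_ : ξ ∈ U) (s : CentreSeq (U : Scheme.{u})),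
      s.IsResolutionOf ⟨E.J.comap U.ι, [], E.b⟩ := by
  letI : A.Z.Over (Spec (.of K)) := ⟨A.hom⟩
  haveI : Smooth (A.Z ↘ Spec (.of K)) := A.smooth
  have hbp : E.b < p := hE
  exact Kollar2007.exists_isResolutionOf_nhd_of_ringKrullDim_le_two K A.Z p E.J hb (Or.inr hbp) hmax ξ hξ hdim

/-- [OURS · L1 W4.6 (iv) ∩ (i); NOT a statement of the manuscript] **In the regime `charGT n (fun _ b ↦ b) ∩ dimLE 2`
(«`p > b`», «`dim Z ≤ 2`»), at EVERY closed point of every state of maximal order `b ≥ 1`, the characteristic-zero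
order reduction terminates locally**: an open `U ∋ ξ` carries a smooth blow-up sequence resolving `(U, J|_U, ∅, b)`
(`CentreSeq.IsResolutionOf`: regular centres in the successive `Sing`, simple normal crossings with the exceptional
boundary, final `Sing` empty). Instance of `Kollar2007.exists_isResolutionOf_nhd_of_topologicalKrullDim_le_two`
(`dim 𝒪_{Z,ξ} ≤ dim Z ≤ 2`). [cite: Kollar2007, Thm. 3.69] -/
theorem exists_isResolutionOf_nhd_of_charGT_dimLE [PerfectField K] (A : AmbientDatum p K) (E : IdealExponent A.Z)
    (hE : Regime.inter (Regime.charGT (p := p) (K := K) n (fun _ b => b)) (Regime.dimLE 2) A E) (hb : 1 ≤ E.b)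
    (hmax : ∀ ξ : A.Z, idealOrder E.J ξ ≤ E.b) (ξ : A.Z) (hξ : IsClosed ({ξ} : Set A.Z)) :
    ∃ (U : A.Z.Opens) (_ : ξ ∈ U) (s : CentreSeq (U : Scheme.{u})),
      s.IsResolutionOf ⟨E.J.comap U.ι, [], E.b⟩ := by
  letI : A.Z.Over (Spec (.of K)) := ⟨A.hom⟩
  haveI : Smooth (A.Z ↘ Spec (.of K)) := A.smooth
  have hbp : E.b < p := hE.1
  have hdim : topologicalKrullDim A.Z ≤ 2 := hE.2
  exact Kollar2007.exists_isResolutionOf_nhd_of_topologicalKrullDim_le_two K A.Z p hdim E.J hb (Or.inr hbp)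
    hmax ξ hξ

/-- [OURS · L1 W4.6 (iv) ∩ (i)] The same in every regime `Regime.charGT n f ∩ Regime.dimLE 2` whose threshold
dominates the order, `(fun _ b ↦ b) ≤ f` (e.g. the prior's V5 threshold `fun _ b ↦ b !`), by `Regime.charGT_of_le`
(p471737). [cite: Kollar2007, Thm. 3.69] -/
theorem exists_isResolutionOf_nhd_of_le_dimLE [PerfectField K] {f : ℕ → ℕ → ℕ} (hf : (fun _ b : ℕ => b) ≤ f)
    (A : AmbientDatum p K) (E : IdealExponent A.Z)
    (hE : Regime.inter (Regime.charGT (p := p) (K := K) n f) (Regime.dimLE 2) A E) (hb : 1 ≤ E.b)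
    (hmax : ∀ ξ : A.Z, idealOrder E.J ξ ≤ E.b) (ξ : A.Z) (hξ : IsClosed ({ξ} : Set A.Z)) :
    ∃ (U : A.Z.Opens) (_ : ξ ∈ U) (s : CentreSeq (U : Scheme.{u})),
      s.IsResolutionOf ⟨E.J.comap U.ι, [], E.b⟩ :=
  exists_isResolutionOf_nhd_of_charGT_dimLE A E ⟨Regime.charGT_of_le (fun b => hf n b) A E hE.1, hE.2⟩ hb hmax ξ hξ

end TameSurfaceOrderReduction
end CampaignW46
end Summit.ResolutionOfSingularities.ResolutionOfSingularities.Theorems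

end
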